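import Summits.NavierStokesRegularity.NavierStokesRegularity.Theorems.SkeletonEquilibrium.Negative.SkeletonEquilibriumFalseOfZeroAccretionSelection
import Summits.NavierStokesRegularity.NavierStokesRegularity.Theorems.FilamentSkeletonRssSkeletonEquilibriumMirrorPointSelection

/-!
# The hold hypothesis `ZeroAccretionSelection` of crux `SkeletonEquilibrium` (stmt-NavierStokesRegularity-15400), reduced

The crux K1 = `FilamentSkeletonRss.SkeletonEquilibrium` is HELD by the negative lemma
`Negative.SkeletonEquilibrium_false_of_ZeroAccretionSelection : ZeroAccretionSelection → ¬ SkeletonEquilibrium`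
(p171508), where `ZeroAccretionSelection = LengthRegular ∧ MirrorPointSelection ∧ StrandSeparation ∧
ZeroAccretionShadowing` restates VERBATIM the four conjectural stubs of the negation line
`zero-accretion-selection` (`Cruxes/SkeletonEquilibrium/Lines/zero_accretion_selection.lean`, v5).

Since then the registered stub `stub_mirrorPointSelection` has LANDED
(`MirrorPoint.stub_mirrorPointSelection`, p826181: rigidity of the first-order gyration-free locus of the outer ODE
`Yo″ = (4π/γ_k) • Yo′ × (½Yo − αe₃×Yo)` + continuous dependence + compactness; no numerics).
This file records the consequence for the hold, kernel-checked:

* `mirrorPointSelection_holds : MirrorPointSelection` — the conjunct H₂ is a theorem;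
* `zeroAccretionSelection_iff_three : ZeroAccretionSelection ↔ LengthRegular ∧ StrandSeparation ∧ ZeroAccretionShadowing`;
* `SkeletonEquilibrium_false_of_three : LengthRegular → StrandSeparation → ZeroAccretionShadowing → ¬ SkeletonEquilibrium`;
* `not_skeletonEquilibrium_iff_of_lengthRegular (h : LengthRegular) :
    ¬ SkeletonEquilibrium ↔ (StrandSeparation ∧ ZeroAccretionShadowing)` — modulo the ONE remaining SC-free
  conjunct (length-regularity of ALL relative equilibria at scales `≥ √Γ`), the negated crux is EQUIVALENT to the
  pair of SC-conjuncts, both of which are corollaries of `¬ SkeletonEquilibrium` by the landed certificate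
  `stub_cruxSizedCertificate` (p169635);
* `zeroAccretionSelection_iff_not_skeletonEquilibrium_of_lengthRegular (h : LengthRegular) :
    ZeroAccretionSelection ↔ ¬ SkeletonEquilibrium`.

HONEST LABEL: bookkeeping for a HELD support item; it lowers nothing (the XL core `ZeroAccretionShadowing` and
`StrandSeparation` stay crux-sized) and proves no summit statement; Navier–Stokes regularity is not touched.
What is new is only that the SC-free half of the hold hypothesis is now the single statement `LengthRegular`.
-/

noncomputable section

-- `Summit.<Summit>.<Problem>`: single-conjunct summit, the duplicate segment is mandated (CONVENTIONS §2).
set_option linter.dupNamespace false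

namespace Summit.NavierStokesRegularity.NavierStokesRegularity.Theorems.SkeletonEquilibrium.Negative

open Summit.NavierStokesRegularity.NavierStokesRegularity.Theses.FilamentSkeletonRss (SkeletonEquilibrium)

/-- **H₂ holds.** The conjunct `MirrorPointSelection` of the hold hypothesis is the registered stub
`stub_mirrorPointSelection` verbatim, landed as `MirrorPoint.stub_mirrorPointSelection` (p826181). [folklore] -/
theorem mirrorPointSelection_holds : MirrorPointSelection :=
  _root_.Summit.NavierStokesRegularity.NavierStokesRegularity.Theorems.SkeletonEquilibrium.MirrorPoint.stub_mirrorPointSelection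

/-- **The hold hypothesis has three live conjuncts.**
`ZeroAccretionSelection ↔ LengthRegular ∧ StrandSeparation ∧ ZeroAccretionShadowing`. [folklore] -/
theorem zeroAccretionSelection_iff_three :
    ZeroAccretionSelection ↔ (LengthRegular ∧ StrandSeparation ∧ ZeroAccretionShadowing) :=
  ⟨fun h => ⟨h.1, h.2.2.1, h.2.2.2⟩, fun h => ⟨h.1, mirrorPointSelection_holds, h.2.1, h.2.2⟩⟩

/-- Constructor form: the three live conjuncts give the hold hypothesis. [folklore] -/
theorem zeroAccretionSelection_of_three (hLR : LengthRegular) (hSS : StrandSeparation)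
    (hZA : ZeroAccretionShadowing) : ZeroAccretionSelection :=
  zeroAccretionSelection_iff_three.2 ⟨hLR, hSS, hZA⟩

/-- **The crux is false modulo the three live conjuncts** (the negative lemma with H₂ discharged). [folklore] -/
theorem SkeletonEquilibrium_false_of_three (hLR : LengthRegular) (hSS : StrandSeparation)
    (hZA : ZeroAccretionShadowing) : ¬ SkeletonEquilibrium :=
  SkeletonEquilibrium_false_of_ZeroAccretionSelection (zeroAccretionSelection_of_three hLR hSS hZA)

/-- **The gap, with one SC-free hypothesis left.** Given length-regularity of all relative equilibria
(`LengthRegular`, the registered SC-free stub `stub_lengthRegular` shared by the three negation lines), the negated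
crux is EQUIVALENT to the pair of SC-conjuncts `StrandSeparation ∧ ZeroAccretionShadowing` (each a corollary of
`¬ SkeletonEquilibrium` by the landed certificate p169635). [folklore] -/
theorem not_skeletonEquilibrium_iff_of_lengthRegular (hLR : LengthRegular) :
    ¬ SkeletonEquilibrium ↔ (StrandSeparation ∧ ZeroAccretionShadowing) :=
  not_skeletonEquilibrium_iff_of_scFree hLR mirrorPointSelection_holds

/-- Given `LengthRegular` alone, the hold hypothesis is equivalent to the negated crux. [folklore] -/
theorem zeroAccretionSelection_iff_not_skeletonEquilibrium_of_lengthRegular (hLR : LengthRegular) :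
    ZeroAccretionSelection ↔ ¬ SkeletonEquilibrium :=
  zeroAccretionSelection_iff_not_skeletonEquilibrium hLR mirrorPointSelection_holds

/-- One-directional summary needing NO hypothesis: a refutation of the crux already yields every SC-conjunct of the
hold hypothesis, so what a refutation of K1-as-typed must still supply beyond `¬ SkeletonEquilibrium`-equivalent
content is exactly `LengthRegular`. [folklore] -/
theorem zeroAccretionSelection_of_not_skeletonEquilibrium (hLR : LengthRegular) (hneg : ¬ SkeletonEquilibrium) :
    ZeroAccretionSelection :=
  (zeroAccretionSelection_iff_not_skeletonEquilibrium_of_lengthRegular hLR).2 hneg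

end Summit.NavierStokesRegularity.NavierStokesRegularity.Theorems.SkeletonEquilibrium.Negative

end
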